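import Mathlib
import Literature.LinearAlgebra.Matrix.RankOneDowndate
import HarnessLib

/-!
# Determinants under rank-one downdates: `det(1 + D − Σ vₗvₗ*) ≥ e^{−Σ‖vₗ‖²} det(1 + D)`

Linear-algebra input of the MULTISCALE (entrywise) rigidity bound for Haar unitaries (route
`EguchiKawaiDirectionLadder`, crux `TripleSmallBallMargin`, stub plan A1 «generic-region count»): when the
Gram–Schmidt column `P_{Kᗮ} g` of a Gaussian vector is tested against a WEIGHTED quadratic form
`D = diag(a)`, the Gaussian Chernoff bound produces `det(1 + D^{1/2} P_{Kᗮ} D^{1/2}/b)⁻¹`, and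
`D^{1/2} P_{Kᗮ} D^{1/2} = D − Σₗ (D^{1/2}wₗ)(D^{1/2}wₗ)*` is a sum of rank-one downdates of `D` by the
previous columns `wₗ`.  The main result `det_re_one_add_sub_sum_vecMulVec_ge`:

  if `D − Σₗ vₗ vₗ*` is positive semidefinite then
  `e^{−Σₗ ‖vₗ‖²} · Re det(1 + D) ≤ Re det(1 + D − Σₗ vₗ vₗ*)`,

i.e. the weighted defect of the previous columns costs only the factor `e^{−Σ‖vₗ‖²}` (no lost
dimensions, no logarithms).  Proof: peel the downdates one at a time with the matrix determinant lemma
(`det_re_sub_vecMulVec`, tree) and the scalar inequality `re_star_dotProduct_inv_mulVec_le`: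
`u* M⁻¹ u ≤ ‖u‖²/(1 + ‖u‖²)` whenever `M ≥ 1 + u u*`.  All [folklore].
-/

noncomputable section

open Matrix Finset
open Literature.LinearAlgebra.Matrix
open scoped ComplexOrder

namespace Summit.QuantumFields.YangMills.Theorems.EguchiKawaiDirectionLadder.HaarColumns

variable {n : Type*} [Fintype n] [DecidableEq n]

omit [DecidableEq n] in
/-- **Cauchy–Schwarz** for the Hermitian dot product: `|star u ⬝ᵥ x|² ≤ (Σ|u_i|²)(Σ|x_i|²)`. [folklore] -/
theorem norm_sq_star_dotProduct_le (u x : n → ℂ) :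
    ‖star u ⬝ᵥ x‖ ^ 2 ≤ (∑ i, ‖u i‖ ^ 2) * (∑ i, ‖x i‖ ^ 2) := by
  have h : star u ⬝ᵥ x = inner ℂ (WithLp.toLp 2 u : EuclideanSpace ℂ n) (WithLp.toLp 2 x) := by
    rw [EuclideanSpace.inner_toLp_toLp, dotProduct_comm]
  rw [h]
  have hcs := norm_inner_le_norm (𝕜 := ℂ) (WithLp.toLp 2 u : EuclideanSpace ℂ n) (WithLp.toLp 2 x)
  have h1 : ‖(WithLp.toLp 2 u : EuclideanSpace ℂ n)‖ ^ 2 = ∑ i, ‖u i‖ ^ 2 := by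
    rw [EuclideanSpace.norm_sq_eq]
  have h2 : ‖(WithLp.toLp 2 x : EuclideanSpace ℂ n)‖ ^ 2 = ∑ i, ‖x i‖ ^ 2 := by
    rw [EuclideanSpace.norm_sq_eq]
  rw [← h1, ← h2, ← mul_pow]
  exact pow_le_pow_left₀ (norm_nonneg _) hcs 2

/-- **The key scalar inequality.** If `M` is positive definite and `M − 1 − u u*` is positive
semidefinite, then `Re (u* M⁻¹ u) ≤ ‖u‖² / (1 + ‖u‖²)`. (With `x = M⁻¹u` and `c = u*x`:
`c = x* M x ≥ ‖x‖² + |c|²` and `|c|² ≤ ‖u‖²‖x‖²`.) [folklore] -/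
theorem re_star_dotProduct_inv_mulVec_le {M : Matrix n n ℂ} (hM : M.PosDef) (u : n → ℂ)
    (h : (M - 1 - vecMulVec u (star u)).PosSemidef) :
    (star u ⬝ᵥ M⁻¹ *ᵥ u).re ≤ (∑ i, ‖u i‖ ^ 2) / (1 + ∑ i, ‖u i‖ ^ 2) := by
  set x : n → ℂ := M⁻¹ *ᵥ u with hx
  have hMunit : IsUnit M.det := isUnit_iff_ne_zero.2 hM.det_pos.ne'
  have hMx : M *ᵥ x = u := by
    rw [hx, mulVec_mulVec, mul_nonsing_inv _ hMunit, one_mulVec]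
  set c : ℂ := star u ⬝ᵥ x with hc
  -- `c` is real and nonnegative
  have hcre := star_dotProduct_mulVec_nonneg hM.inv.posSemidef u
  have hc_eq : c = (c.re : ℂ) := Complex.ext rfl (by rw [Complex.ofReal_im]; exact hcre.2)
  set r : ℝ := c.re with hr
  have hr0 : 0 ≤ r := hcre.1
  set U : ℝ := ∑ i, ‖u i‖ ^ 2 with hU
  set X : ℝ := ∑ i, ‖x i‖ ^ 2 with hX
  have hU0 : 0 ≤ U := by positivity
  have hX0 : 0 ≤ X := by positivity
  -- `star x ⬝ᵥ x = Σ |x_i|²`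
  have hxx : star x ⬝ᵥ x = (X : ℂ) := by
    rw [hX, dotProduct, Complex.ofReal_sum]
    refine Finset.sum_congr rfl fun i _ => ?_
    rw [Pi.star_apply, Complex.star_def, Complex.conj_mul', Complex.ofReal_pow]
  -- `x* M x = conj c`
  have h1 : star x ⬝ᵥ M *ᵥ x = star c := by
    rw [hMx, hc, star_dotProduct]
  -- positivity of `M - 1 - u u*` at `x`
  have h2 := star_dotProduct_mulVec_nonneg h x
  have hexpand : star x ⬝ᵥ (M - 1 - vecMulVec u (star u)) *ᵥ x = star c - (X : ℂ) - c * star c := by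
    rw [sub_mulVec, sub_mulVec, one_mulVec, vecMulVec_mulVec, dotProduct_sub, dotProduct_sub, h1,
      hxx]
    congr 1
    rw [op_smul_eq_smul, dotProduct_smul, ← hc, smul_eq_mul]
    rw [show star x ⬝ᵥ u = star c by rw [hc, star_dotProduct]]
  rw [hexpand] at h2
  have h2' : 0 ≤ r - X - r ^ 2 := by
    have := h2.1
    rw [hc_eq] at this
    simpa [Complex.conj_ofReal, sq] using this
  -- Cauchy–Schwarz
  have h3 : r ^ 2 ≤ U * X := by
    have := norm_sq_star_dotProduct_le u x
    rw [← hc, hc_eq, Complex.norm_real, Real.norm_eq_abs, sq_abs] at this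
    exact this
  -- conclude: `r²(1+U) ≤ U r`
  have hkey : r ^ 2 * (1 + U) ≤ U * r := by nlinarith [mul_nonneg hU0 h2', h3]
  show r ≤ U / (1 + U)
  rw [le_div_iff₀ (by linarith)]
  rcases hr0.eq_or_lt with h0 | hpos
  · rw [← h0, zero_mul]; exact hU0
  · by_contra hcon
    push Not at hcon
    have : U * r < r * (1 + U) * r := mul_lt_mul_of_pos_right hcon hpos
    nlinarith

omit [DecidableEq n] in
/-- A sum of rank-one matrices `vₗ vₗ*` is positive semidefinite. [folklore] -/
theorem posSemidef_sum_vecMulVec {k : ℕ} (v : Fin k → n → ℂ) :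
    (∑ l, vecMulVec (v l) (star (v l))).PosSemidef :=
  Finset.sum_induction _ (fun M : Matrix n n ℂ => M.PosSemidef) (fun _ _ ha hb => ha.add hb)
    PosSemidef.zero (fun l _ => posSemidef_vecMulVec_self_star (v l))

/-- **Determinant under rank-one downdates.** If `D − Σₗ vₗvₗ*` is positive semidefinite (so in
particular `D` is), then `e^{−Σₗ‖vₗ‖²} · Re det(1 + D) ≤ Re det(1 + D − Σₗ vₗvₗ*)`.  Peel the downdates:
each costs a factor `1 − u*M⁻¹u ≥ 1/(1 + ‖u‖²) ≥ e^{−‖u‖²}` by `re_star_dotProduct_inv_mulVec_le`.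
[folklore] -/
theorem det_re_one_add_sub_sum_vecMulVec_ge :
    ∀ (k : ℕ) (D : Matrix n n ℂ) (v : Fin k → n → ℂ),
      (D - ∑ l, vecMulVec (v l) (star (v l))).PosSemidef →
        Real.exp (-(∑ l, ∑ i, ‖v l i‖ ^ 2)) * (1 + D).det.re ≤
          (1 + (D - ∑ l, vecMulVec (v l) (star (v l)))).det.re := by
  intro k
  induction k with
  | zero =>
    intro D v hD
    simp
  | succ k ih =>
    intro D v hP
    -- split off the last downdate
    set v' : Fin k → n → ℂ := fun l => v (Fin.castSucc l) with hv'
    set u : n → ℂ := v (Fin.last k) with hu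
    have hsum : ∑ l, vecMulVec (v l) (star (v l)) =
        ∑ l, vecMulVec (v' l) (star (v' l)) + vecMulVec u (star u) := by
      rw [Fin.sum_univ_castSucc]
    have hnorm : ∑ l, ∑ i, ‖v l i‖ ^ 2 = (∑ l, ∑ i, ‖v' l i‖ ^ 2) + ∑ i, ‖u i‖ ^ 2 := by
      rw [Fin.sum_univ_castSucc]
    set M : Matrix n n ℂ := 1 + (D - ∑ l, vecMulVec (v' l) (star (v' l))) with hM
    -- the matrix before the last downdate dominates `1 + u u*`
    have hR : (D - ∑ l, vecMulVec (v' l) (star (v' l))).PosSemidef := by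
      have : D - ∑ l, vecMulVec (v' l) (star (v' l)) =
          (D - ∑ l, vecMulVec (v l) (star (v l))) + vecMulVec u (star u) := by
        rw [hsum]; abel
      rw [this]
      exact hP.add (posSemidef_vecMulVec_self_star u)
    have hMpd : M.PosDef := by
      rw [hM]; exact PosDef.one.add_posSemidef hR
    have hMsub : (M - 1 - vecMulVec u (star u)).PosSemidef := by
      have : M - 1 - vecMulVec u (star u) = D - ∑ l, vecMulVec (v l) (star (v l)) := by
        rw [hM, hsum]; abel
      rw [this]; exact hP
    -- induction hypothesis
    have hIH := ih D v' hR
    -- the last factor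
    have hfinal : (1 + (D - ∑ l, vecMulVec (v l) (star (v l)))) = M - vecMulVec u (star u) := by
      rw [hM, hsum]; abel
    rw [hfinal, det_re_sub_vecMulVec hMpd u, hnorm, neg_add, Real.exp_add]
    have hq := re_star_dotProduct_inv_mulVec_le hMpd u hMsub
    set U : ℝ := ∑ i, ‖u i‖ ^ 2 with hU
    have hU0 : 0 ≤ U := by positivity
    have hdet0 : 0 < M.det.re := (det_re_pos_of_posDef hMpd).1
    have hfac : Real.exp (-U) ≤ 1 - (star u ⬝ᵥ M⁻¹ *ᵥ u).re := by
      have h1 : Real.exp (-U) ≤ 1 / (1 + U) := by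
        rw [le_div_iff₀ (by linarith), Real.exp_neg]
        have := Real.add_one_le_exp U
        calc (Real.exp U)⁻¹ * (1 + U) ≤ (Real.exp U)⁻¹ * Real.exp U := by gcongr; linarith
          _ = 1 := inv_mul_cancel₀ (Real.exp_pos U).ne'
      have h2 : 1 / (1 + U) ≤ 1 - (star u ⬝ᵥ M⁻¹ *ᵥ u).re := by
        have : 1 / (1 + U) = 1 - U / (1 + U) := by field_simp; ring
        rw [this]; linarith
      exact h1.trans h2
    calc Real.exp (-∑ l, ∑ i, ‖v' l i‖ ^ 2) * Real.exp (-U) * (1 + D).det.re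
        = Real.exp (-U) * (Real.exp (-∑ l, ∑ i, ‖v' l i‖ ^ 2) * (1 + D).det.re) := by ring
      _ ≤ (1 - (star u ⬝ᵥ M⁻¹ *ᵥ u).re) * M.det.re := by
          have hD : D.PosSemidef := by
            have := hP.add (posSemidef_sum_vecMulVec v)
            rwa [sub_add_cancel] at this
          refine mul_le_mul hfac hIH ?_ ?_
          · exact mul_nonneg (Real.exp_pos _).le
              (le_of_lt (det_re_pos_of_posDef (PosDef.one.add_posSemidef hD)).1)
          · exact (Real.exp_pos _).le.trans hfac
      _ = M.det.re * (1 - (star u ⬝ᵥ M⁻¹ *ᵥ u).re) := mul_comm _ _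

end Summit.QuantumFields.YangMills.Theorems.EguchiKawaiDirectionLadder.HaarColumns

end
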